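import Summits.ResolutionOfSingularities.ResolutionOfSingularities.Theorems.FrobeniusClosingSteerLowTowerCritical
import Literature.AlgebraicGeometry.Resolution.LocalBlowup
import Literature.AlgebraicGeometry.Resolution.QuadraticTransforms
import Literature.AlgebraicGeometry.Resolution.RsopMonomialIdeals
import Mathlib.RingTheory.Derivation.Basic
import HarnessLib

/-!
# Crux `Steer` (stmt-ResolutionOfSingularities-16345), chain W4.1, LOW branch §σ2.24 D3a (A2): **(B3) the critical-surface THREAD of the
# LOW sub-run — the run-level induction `criticalThread` (hypothesis form over the one-step theorem (B2b))**

OURS (campaign `res-hironaka`, rung L ★L-G4, slot W4.1; seat res-type-096 g9 as PARALLEL HAND for res-L0-w41-stub-3 g6 on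
res-L0-w41-plan-1 RULING 96, 2026-08-27T10:55:09Z; replaces the role of no printed item; NOT a statement of the manuscript under review
[claim: Hironaka2017, status: under-review]; AI-produced, weaker than expert review). Theses-free and definition-free.

CONTENT. res-D-pv-012 AS res-L0-w41-stub-8's D3a assembly `exists_lowTower` (statement of record `LowTowerExists.statement.lean`
0b805f4f051c14e3) consumes two run-level inputs about the LOW sub-run `R (i₀ + ·)` read in the local ring `Λ = (R i₀)_𝔮₀` of the first
all-LOW member at its critical prime `𝔮₀ = (δ₁ f, δ₂ f)`: `hthread` (every later member lies in `Λ` and is reached by a point step or a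
curve step with the printed chart shapes) and `hinv` (at every member the trace of `𝔪_Λ` is generated by a Jacobian pair which is part of a
regular system of parameters, with unit Hessian). res-L0-w41-stub-3's (A2) DESIGN (2026-08-27T09:52:08Z) proves them by induction on the
stage with the invariant Inv(n) = `hinv n`; the ONE-STEP theorem (B2b) `criticalThreadStep` (Inv(R) + the σ_top step + next stage
singular ⇒ `R' ≤ Λ` ∧ Inv(R') ∧ the point/curve chart clauses; statement of record `CriticalThreadStep.statement.lean` ce41c1df407c1344)
is stub-3's. THIS FILE is the induction: `criticalThread` takes (B2b) as the named hypothesis `hstep` (its statement VERBATIM, universally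
quantified) and delivers `hthread ∧ hinv` in pv-012's binder shapes VERBATIM, from the unfolded `IsSteeredRun` clauses of the sub-run
(centre dichotomy with the permissible data made explicit, `IsLocalBlowupAlong`, exceptional parameter, strict transform), the singularity of
every stage (`LowStageSingular.steeredStage_singular`), and the base Inv(i₀) (res-type-072's (A1′) low-shape duals). Bookkeeping proved here:
(Λ2)/(Λ4) propagate along the thread (`Λ = (R n)_{𝔮 n}` for every `n`), members dominate (`SubringDominates` along local blowing ups of
`O`-dominated rings), and the exceptional parameter is a non-zero non-unit.

[cite: Cutkosky2014, §2.1] [cite: NovacoskiSpivakovsky2014, Def. 2.11] [folklore]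
-/

noncomputable section

-- `Summit.<S>.<S>.…` duplicates the summit name by design (single-problem summit).
set_option linter.dupNamespace false

open IsLocalRing

namespace Summit.ResolutionOfSingularities.ResolutionOfSingularities.Theorems.SwitchingDichotomy

open Literature.AlgebraicGeometry.Resolution

namespace CriticalThread

variable {K : Type} [Field K]

/-! ## §1 Bookkeeping along the thread -/

/-- A member dominated by `O` is dominated by its local blowing up with respect to `O`. [folklore] -/
theorem subringDominates_of_isLocalBlowupAlong {O : ValuationSubring K} {R R' : Subring K} {P : Ideal R}
    (hbl : IsLocalBlowupAlong O R P R') (hRO : SubringDominates R O.toSubring) : SubringDominates R R' :=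
  hRO.of_le_of_le hbl.isLocalBlowup.le hbl.isLocalBlowup.target_le

/-- A non-unit of a subring of a field which is a unit of a larger subring `Λ` has its inverse in `Λ`. [folklore] -/
theorem inv_mem_of_isUnit_of_le {R Λ : Subring K} (hle : R ≤ Λ) {r : K} (hr : r ∈ R)
    (hu : IsUnit (⟨r, hle hr⟩ : Λ)) : r⁻¹ ∈ Λ :=
  ((isUnit_subring_iff_inv_mem _).mp hu).2

/-! ## §2 The run-level induction -/

/-- **(B3) THE CRITICAL-SURFACE THREAD (hypothesis form).** Along the sub-run `R (i₀ + ·)` of a σ_top-steered `2`-torsor run (members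
regular local of dimension `4` dominated by `O`, residues squares; each step = centre `P (i₀+n)` — the closed point, or the explicit
permissible data `P ≠ 𝔪`, `P` prime, `R ⧸ P` regular, `f − g² ∈ P²` —, local blowing up along it with respect to `O`, exceptional parameter
`x` of maximal value on the centre, strict transform `s = x·s' + G`; every stage singular), given the first member's Jacobian pair
`δ₁, δ₂` (the (A1′) LOW-shape duals: `𝔮₀ = (δ₁ f, δ₂ f)` is generated by part of a regular system of parameters, unit Hessian) and
`Λ = (R i₀)_𝔮₀ ⊆ K` ((Λ1)(Λ2)(Λ4)), and ASSUMING THE ONE-STEP THEOREM (B2b) `hstep` (res-L0-w41-stub-3, statement of record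
`CriticalThreadStep.statement.lean` ce41c1df407c1344, VERBATIM): the THREADING `hthread` and the INVARIANT `hinv` of res-D-pv-012's
`exists_lowTower` hold at every stage (induction on `n`; (Λ2)/(Λ4) re-derived at each stage from `hinv n`). OURS. [folklore] -/
theorem criticalThread
    (O : ValuationSubring K) (R : ℕ → Subring K) (P : (i : ℕ) → Ideal (R i)) (s : ℕ → K) (i₀ : ℕ)
    (hreg : ∀ n, IsRegularLocalRing (R (i₀ + n)))
    (hRO : ∀ n, SubringDominates (R (i₀ + n)) O.toSubring)
    (hdim : ∀ n, ringKrullDim (R (i₀ + n)) = (4 : ℕ))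
    (hperf : ∀ n (a : R (i₀ + n)), ∃ b : R (i₀ + n), a - b ^ 2 ∈ maximalIdeal (R (i₀ + n)))
    (hs2 : ∀ n, s (i₀ + n) ^ 2 ∈ R (i₀ + n))
    -- the run from `i₀`: the unfolded `IsSteeredRun` clauses, the permissible data made explicit
    (hrun : ∀ n,
      (P (i₀ + n) = maximalIdeal (R (i₀ + n)) ∨
        (P (i₀ + n) ≠ maximalIdeal (R (i₀ + n)) ∧ (P (i₀ + n)).IsPrime ∧
          IsRegularLocalRing (R (i₀ + n) ⧸ P (i₀ + n)) ∧
          ∃ g : R (i₀ + n), (⟨s (i₀ + n) ^ 2, hs2 n⟩ : R (i₀ + n)) - g ^ 2 ∈ P (i₀ + n) ^ 2)) ∧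
      IsLocalBlowupAlong O (R (i₀ + n)) (P (i₀ + n)) (R (i₀ + n + 1)) ∧
      ∃ x G : K, (∃ hx : x ∈ R (i₀ + n), (⟨x, hx⟩ : R (i₀ + n)) ∈ P (i₀ + n)) ∧ x ≠ 0 ∧
        (∀ y : R (i₀ + n), y ∈ P (i₀ + n) → O.valuation (y : K) ≤ O.valuation x) ∧
        G ∈ R (i₀ + n) ∧ s (i₀ + n) = x * s (i₀ + n + 1) + G)
    -- every stage is singular
    (hsing : ∀ n, ∃ γ : R (i₀ + n), (⟨s (i₀ + n) ^ 2, hs2 n⟩ : R (i₀ + n)) - γ ^ 2 ∈ maximalIdeal (R (i₀ + n)) ^ 2)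
    -- `Λ = (R i₀)_𝔮₀` and the base invariant
    (Λ : Subring K) (h1 : R (i₀ + 0) ≤ Λ) (δ₁ δ₂ : Derivation ℤ (R (i₀ + 0)) (R (i₀ + 0)))
    (h2 : ∀ r (hr : r ∈ R (i₀ + 0)), (⟨r, hr⟩ : R (i₀ + 0)) ∉
      Ideal.span {δ₁ ⟨s (i₀ + 0) ^ 2, hs2 0⟩, δ₂ ⟨s (i₀ + 0) ^ 2, hs2 0⟩} → r⁻¹ ∈ Λ)
    (h4 : ∀ z ∈ Λ, ∃ a u : K, ∃ (_ : a ∈ R (i₀ + 0)) (hu : u ∈ R (i₀ + 0)),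
      (⟨u, hu⟩ : R (i₀ + 0)) ∉ Ideal.span {δ₁ ⟨s (i₀ + 0) ^ 2, hs2 0⟩, δ₂ ⟨s (i₀ + 0) ^ 2, hs2 0⟩} ∧ z = a / u)
    (hrsop₀ : IsRsopPart ![δ₁ ⟨s (i₀ + 0) ^ 2, hs2 0⟩, δ₂ ⟨s (i₀ + 0) ^ 2, hs2 0⟩])
    (hHess₀ : IsUnit (δ₁ (δ₁ ⟨s (i₀ + 0) ^ 2, hs2 0⟩) * δ₂ (δ₂ ⟨s (i₀ + 0) ^ 2, hs2 0⟩) -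
      δ₁ (δ₂ ⟨s (i₀ + 0) ^ 2, hs2 0⟩) * δ₂ (δ₁ ⟨s (i₀ + 0) ^ 2, hs2 0⟩)))
    (pt : Set ℕ) (hpt : ∀ n, n ∈ pt ↔ P (i₀ + n) = maximalIdeal (R (i₀ + n)))
    -- (B2b) the one-step theorem, VERBATIM as a hypothesis
    (hstep : ∀ (R R' : Subring K) [IsRegularLocalRing R] [IsRegularLocalRing R'],
      SubringDominates R O.toSubring → ringKrullDim R = (4 : ℕ) → ringKrullDim R' = (4 : ℕ) →
      (∀ a : R, ∃ b : R, a - b ^ 2 ∈ maximalIdeal R) →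
      ∀ (P : Ideal R), IsLocalBlowupAlong O R P R' →
      ∀ (s s' x G : K) (hs : s ^ 2 ∈ R) (hs' : s' ^ 2 ∈ R'),
      (P = maximalIdeal R ∨
        (P ≠ maximalIdeal R ∧ P.IsPrime ∧ IsRegularLocalRing (R ⧸ P) ∧ ∃ g : R, (⟨s ^ 2, hs⟩ : R) - g ^ 2 ∈ P ^ 2)) →
      (∃ hxR : x ∈ R, (⟨x, hxR⟩ : R) ∈ P) → x ≠ 0 →
      (∀ y : R, y ∈ P → O.valuation (y : K) ≤ O.valuation x) →
      G ∈ R → s = x * s' + G →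
      (∃ γ : R', (⟨s' ^ 2, hs'⟩ : R') - γ ^ 2 ∈ maximalIdeal R' ^ 2) →
      ∀ (Λ : Subring K) (hle : R ≤ Λ) (δ₁ δ₂ : Derivation ℤ R R),
      (∀ r (hr : r ∈ R), (⟨r, hr⟩ : R) ∉ Ideal.span {δ₁ ⟨s ^ 2, hs⟩, δ₂ ⟨s ^ 2, hs⟩} → r⁻¹ ∈ Λ) →
      (∀ z ∈ Λ, ∃ a u : K, ∃ (_ : a ∈ R) (hu : u ∈ R),
        (⟨u, hu⟩ : R) ∉ Ideal.span {δ₁ ⟨s ^ 2, hs⟩, δ₂ ⟨s ^ 2, hs⟩} ∧ z = a / u) →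
      (∀ r : R, r ∈ Ideal.span {δ₁ ⟨s ^ 2, hs⟩, δ₂ ⟨s ^ 2, hs⟩} ↔ ¬ IsUnit (⟨(r : K), hle r.2⟩ : Λ)) →
      IsRsopPart ![δ₁ ⟨s ^ 2, hs⟩, δ₂ ⟨s ^ 2, hs⟩] →
      IsUnit (δ₁ (δ₁ ⟨s ^ 2, hs⟩) * δ₂ (δ₂ ⟨s ^ 2, hs⟩) - δ₁ (δ₂ ⟨s ^ 2, hs⟩) * δ₂ (δ₁ ⟨s ^ 2, hs⟩)) →
      ∃ hle' : R' ≤ Λ,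
        (∃ δ₁' δ₂' : Derivation ℤ R' R',
          (∀ r : R', r ∈ Ideal.span {δ₁' ⟨s' ^ 2, hs'⟩, δ₂' ⟨s' ^ 2, hs'⟩} ↔ ¬ IsUnit (⟨(r : K), hle' r.2⟩ : Λ)) ∧
          IsRsopPart ![δ₁' ⟨s' ^ 2, hs'⟩, δ₂' ⟨s' ^ 2, hs'⟩] ∧
          IsUnit (δ₁' (δ₁' ⟨s' ^ 2, hs'⟩) * δ₂' (δ₂' ⟨s' ^ 2, hs'⟩) -
            δ₁' (δ₂' ⟨s' ^ 2, hs'⟩) * δ₂' (δ₁' ⟨s' ^ 2, hs'⟩))) ∧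
        (P = maximalIdeal R →
          (∀ y (hy : y ∈ R), ¬ IsUnit (⟨y, hy⟩ : R) → y / x ∈ O) ∧ R' = locAtCentre (blowupRing R x) O) ∧
        (P ≠ maximalIdeal R → ∃ S : Finset K, (↑S : Set K) ⊆ ↑O ∧
          (∀ z ∈ S, ∃ r ∈ R, ∃ hzr : z - r ∈ Λ, ¬ IsUnit (⟨z - r, hzr⟩ : Λ)) ∧
          R' = locAtCentre (Subring.closure ((R : Set K) ∪ ↑S)) O)) :
    -- `hthread` VERBATIM (res-D-pv-012 `exists_lowTower`)
    (∀ n : ℕ, R (i₀ + n) ≤ Λ ∧ SubringDominates (R (i₀ + n)) (R (i₀ + n + 1)) ∧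
      ∃ x G : K, ∃ hx : x ∈ R (i₀ + n), G ∈ R (i₀ + n) ∧ x ≠ 0 ∧ ¬ IsUnit (⟨x, hx⟩ : R (i₀ + n)) ∧
        s (i₀ + n) = x * s (i₀ + n + 1) + G ∧
        (n ∈ pt → (∀ y (hy : y ∈ R (i₀ + n)), ¬ IsUnit (⟨y, hy⟩ : R (i₀ + n)) → y / x ∈ O) ∧
          ∀ hl : IsLocalRing (R (i₀ + n)), R (i₀ + n + 1) = locAtCentre (@blowupRing K _ (R (i₀ + n)) hl x) O) ∧
        (n ∉ pt → ∃ S : Finset K, (↑S : Set K) ⊆ ↑O ∧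
          (∀ z ∈ S, ∃ r ∈ R (i₀ + n), ∃ hzr : z - r ∈ Λ, ¬ IsUnit (⟨z - r, hzr⟩ : Λ)) ∧
          R (i₀ + n + 1) = locAtCentre (Subring.closure ((R (i₀ + n) : Set K) ∪ ↑S)) O)) ∧
    -- `hinv` VERBATIM (res-D-pv-012 `exists_lowTower`)
    (∀ n : ℕ, ∃ (hle : R (i₀ + n) ≤ Λ) (_hl : IsLocalRing (R (i₀ + n))) (hs : s (i₀ + n) ^ 2 ∈ R (i₀ + n))
      (δ₁ δ₂ : Derivation ℤ (R (i₀ + n)) (R (i₀ + n))),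
      (∀ r : R (i₀ + n), r ∈ Ideal.span {δ₁ ⟨s (i₀ + n) ^ 2, hs⟩, δ₂ ⟨s (i₀ + n) ^ 2, hs⟩} ↔
        ¬ IsUnit (⟨(r : K), hle r.2⟩ : Λ)) ∧
      IsRsopPart ![δ₁ ⟨s (i₀ + n) ^ 2, hs⟩, δ₂ ⟨s (i₀ + n) ^ 2, hs⟩] ∧
      IsUnit (δ₁ (δ₁ ⟨s (i₀ + n) ^ 2, hs⟩) * δ₂ (δ₂ ⟨s (i₀ + n) ^ 2, hs⟩) -
        δ₁ (δ₂ ⟨s (i₀ + n) ^ 2, hs⟩) * δ₂ (δ₁ ⟨s (i₀ + n) ^ 2, hs⟩))) := by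
  classical
  -- ### monotonicity of the sub-run
  have hmono : ∀ n, R (i₀ + 0) ≤ R (i₀ + n) := by
    intro n
    induction n with
    | zero => exact le_rfl
    | succ n ih => exact ih.trans (hrun n).2.1.isLocalBlowup.le
  -- ### the base trace: non-units of `Λ` from `R i₀` are exactly `𝔮₀`
  have hprime₀ : (Ideal.span {δ₁ ⟨s (i₀ + 0) ^ 2, hs2 0⟩, δ₂ ⟨s (i₀ + 0) ^ 2, hs2 0⟩}).IsPrime := by
    have h := hrsop₀.isPrime_span_range
    rwa [Matrix.range_cons, Matrix.range_cons, Matrix.range_empty, Set.union_empty, Set.singleton_union] at h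
  have htrace₀ : ∀ r : R (i₀ + 0), r ∈ Ideal.span {δ₁ ⟨s (i₀ + 0) ^ 2, hs2 0⟩, δ₂ ⟨s (i₀ + 0) ^ 2, hs2 0⟩} ↔
      ¬ IsUnit (⟨(r : K), h1 r.2⟩ : Λ) := fun r =>
    (LowTower.not_isUnit_iff_mem (R (i₀ + 0)) Λ _ h1 h2 h4 r).symm
  -- ### the invariant, by induction on the stage
  have key : ∀ n : ℕ, ∃ (hle : R (i₀ + n) ≤ Λ) (D₁ D₂ : Derivation ℤ (R (i₀ + n)) (R (i₀ + n))),
      (∀ r : R (i₀ + n), r ∈ Ideal.span {D₁ ⟨s (i₀ + n) ^ 2, hs2 n⟩, D₂ ⟨s (i₀ + n) ^ 2, hs2 n⟩} ↔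
        ¬ IsUnit (⟨(r : K), hle r.2⟩ : Λ)) ∧
      IsRsopPart ![D₁ ⟨s (i₀ + n) ^ 2, hs2 n⟩, D₂ ⟨s (i₀ + n) ^ 2, hs2 n⟩] ∧
      IsUnit (D₁ (D₁ ⟨s (i₀ + n) ^ 2, hs2 n⟩) * D₂ (D₂ ⟨s (i₀ + n) ^ 2, hs2 n⟩) -
        D₁ (D₂ ⟨s (i₀ + n) ^ 2, hs2 n⟩) * D₂ (D₁ ⟨s (i₀ + n) ^ 2, hs2 n⟩)) := by
    intro n
    induction n with
    | zero => exact ⟨h1, δ₁, δ₂, htrace₀, hrsop₀, hHess₀⟩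
    | succ n ih =>
      obtain ⟨hle, D₁, D₂, htr, hrs, hH⟩ := ih
      haveI := hreg n
      haveI : IsRegularLocalRing (R (i₀ + n + 1)) := hreg (n + 1)
      -- (Λ2) and (Λ4) at stage `n`
      have h2n : ∀ r (hr : r ∈ R (i₀ + n)), (⟨r, hr⟩ : R (i₀ + n)) ∉
          Ideal.span {D₁ ⟨s (i₀ + n) ^ 2, hs2 n⟩, D₂ ⟨s (i₀ + n) ^ 2, hs2 n⟩} → r⁻¹ ∈ Λ := by
        intro r hr hrq
        have hu : IsUnit (⟨r, hle hr⟩ : Λ) := by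
          by_contra hnu
          exact hrq ((htr ⟨r, hr⟩).mpr hnu)
        exact inv_mem_of_isUnit_of_le hle hr hu
      have h4n : ∀ z ∈ Λ, ∃ a u : K, ∃ (_ : a ∈ R (i₀ + n)) (hu : u ∈ R (i₀ + n)),
          (⟨u, hu⟩ : R (i₀ + n)) ∉ Ideal.span {D₁ ⟨s (i₀ + n) ^ 2, hs2 n⟩, D₂ ⟨s (i₀ + n) ^ 2, hs2 n⟩} ∧
            z = a / u := by
        intro z hz
        obtain ⟨a, u, ha, hu, huq, hzu⟩ := h4 z hz
        refine ⟨a, u, hmono n ha, hmono n hu, fun hmem => ?_, hzu⟩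
        have hunit : IsUnit (⟨u, h1 hu⟩ : Λ) := by
          by_contra hnu
          exact huq ((htrace₀ ⟨u, hu⟩).mpr hnu)
        exact ((htr ⟨u, hmono n hu⟩).mp hmem) hunit
      obtain ⟨hP, hbl, x, G, hxP, hx0, hxmax, hG, hst⟩ := hrun n
      obtain ⟨hle', ⟨D₁', D₂', htr', hrs', hH'⟩, -, -⟩ :=
        hstep (R (i₀ + n)) (R (i₀ + n + 1)) (hRO n) (hdim n) (hdim (n + 1)) (hperf n) (P (i₀ + n)) hbl
          (s (i₀ + n)) (s (i₀ + n + 1)) x G (hs2 n) (hs2 (n + 1)) hP hxP hx0 hxmax hG hst (hsing (n + 1))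
          Λ hle D₁ D₂ h2n h4n htr hrs hH
      exact ⟨hle', D₁', D₂', htr', hrs', hH'⟩
  refine ⟨fun n => ?_, fun n => ?_⟩
  · -- ### `hthread n`
    obtain ⟨hle, D₁, D₂, htr, hrs, hH⟩ := key n
    haveI := hreg n
    haveI : IsRegularLocalRing (R (i₀ + n + 1)) := hreg (n + 1)
    have h2n : ∀ r (hr : r ∈ R (i₀ + n)), (⟨r, hr⟩ : R (i₀ + n)) ∉
        Ideal.span {D₁ ⟨s (i₀ + n) ^ 2, hs2 n⟩, D₂ ⟨s (i₀ + n) ^ 2, hs2 n⟩} → r⁻¹ ∈ Λ := by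
      intro r hr hrq
      have hu : IsUnit (⟨r, hle hr⟩ : Λ) := by
        by_contra hnu
        exact hrq ((htr ⟨r, hr⟩).mpr hnu)
      exact inv_mem_of_isUnit_of_le hle hr hu
    have h4n : ∀ z ∈ Λ, ∃ a u : K, ∃ (_ : a ∈ R (i₀ + n)) (hu : u ∈ R (i₀ + n)),
        (⟨u, hu⟩ : R (i₀ + n)) ∉ Ideal.span {D₁ ⟨s (i₀ + n) ^ 2, hs2 n⟩, D₂ ⟨s (i₀ + n) ^ 2, hs2 n⟩} ∧
          z = a / u := by
      intro z hz
      obtain ⟨a, u, ha, hu, huq, hzu⟩ := h4 z hz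
      refine ⟨a, u, hmono n ha, hmono n hu, fun hmem => ?_, hzu⟩
      have hunit : IsUnit (⟨u, h1 hu⟩ : Λ) := by
        by_contra hnu
        exact huq ((htrace₀ ⟨u, hu⟩).mpr hnu)
      exact ((htr ⟨u, hmono n hu⟩).mp hmem) hunit
    obtain ⟨hP, hbl, x, G, hxP, hx0, hxmax, hG, hst⟩ := hrun n
    obtain ⟨-, -, hpt', hcurve⟩ :=
      hstep (R (i₀ + n)) (R (i₀ + n + 1)) (hRO n) (hdim n) (hdim (n + 1)) (hperf n) (P (i₀ + n)) hbl
        (s (i₀ + n)) (s (i₀ + n + 1)) x G (hs2 n) (hs2 (n + 1)) hP hxP hx0 hxmax hG hst (hsing (n + 1))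
        Λ hle D₁ D₂ h2n h4n htr hrs hH
    obtain ⟨hxR, hxPmem⟩ := hxP
    -- the centre lies in the maximal ideal, so `x` is a non-unit
    have hPle : P (i₀ + n) ≤ maximalIdeal (R (i₀ + n)) := by
      rcases hP with hP | ⟨-, hPr, -⟩
      · exact hP.le
      · exact IsLocalRing.le_maximalIdeal hPr.ne_top
    have hxnu : ¬ IsUnit (⟨x, hxR⟩ : R (i₀ + n)) := (mem_maximalIdeal _).mp (hPle hxPmem)
    refine ⟨hle, subringDominates_of_isLocalBlowupAlong hbl (hRO n), x, G, hxR, hG, hx0, hxnu, hst,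
      fun hn => ?_, fun hn => ?_⟩
    · obtain ⟨hO, heq⟩ := hpt' ((hpt n).mp hn)
      exact ⟨hO, fun hl => heq⟩
    · exact hcurve (fun h => hn ((hpt n).mpr h))
  · -- ### `hinv n`
    obtain ⟨hle, D₁, D₂, htr, hrs, hH⟩ := key n
    exact ⟨hle, inferInstance, hs2 n, D₁, D₂, htr, hrs, hH⟩

end CriticalThread

end Summit.ResolutionOfSingularities.ResolutionOfSingularities.Theorems.SwitchingDichotomy

end
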